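import Mathlib
import Literature.AlgebraicGeometry.Morphisms.CechModuleExactH0
import Literature.AlgebraicGeometry.Modules.ExtCohomologyComparison
import Summits.ResolutionOfSingularities.ResolutionOfSingularities.Theorems.HomologicalConductorNoZenoG2CechData
import Summits.ResolutionOfSingularities.ResolutionOfSingularities.Theorems.HomologicalConductorNoZenoFullSheafFreeCompat
import Summits.ResolutionOfSingularities.ResolutionOfSingularities.Theorems.HomologicalConductorNoZenoFullSheafCoh
import Summits.ResolutionOfSingularities.ResolutionOfSingularities.Theorems.HomologicalConductorNoZenoFullSheafGlobalSections
import Summits.ResolutionOfSingularities.ResolutionOfSingularities.Theorems.HomologicalConductorNoZenoFullSheafEmbedding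
import Summits.ResolutionOfSingularities.ResolutionOfSingularities.Theorems.HomologicalConductorNoZenoStableEnd
import HarnessLib

/-!
# Crux `NoZenoR` (stmt-ResolutionOfSingularities-19943), line `sandwich-cluster`, G-layer:
# G2 ASSEMBLY — `End̲_T(M) ≃ₗ[T] Ȟ¹(𝒰, 𝓗om(M~, 𝒦))` from the full-sheaf package

OURS (cell res-hironaka, chain W4.4; KERNEL-L0 §16 R6 row G2 «full-sheaf package», holder
res-D-pv-045 AS res-L0-w44-stub-8; plan `D/res-D-pv-045/SketchG2Assembly.lean` items A4 (the SES), A5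
«`ker δ = P(M, M)`», A7 (the quotient isomorphism) and the ASSEMBLY of G2-MAIN v2
`exists_locallyFree_stableEnd_equiv_cechMH1` from the typed inputs (ii) `fullSheaf_range_linear_eq…`
(res-D-pv-053, p507284/p508324), (iv) «`M~` finite locally free» and (vii) «`Ȟ¹(𝒰, M~^∨) = 0`» —
the last two are HYPOTHESES `hLF`, `hdual` of `exists_locallyFree_stableEnd_equiv_cechMH1_of_inputs`
below, in the exact shape of the hands' targets (`SketchG2Split.lean` v2), to be discharged by name).
Nothing of [claim: Hironaka2017] is used; AI-written, weaker than expert review.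

The argument (Artin–Verdier's reflexive-module dictionary made homological, OURS): for `T` a
noetherian normal domain, `π : X → Spec T` a resolution, `M` a finite reflexive `T`-module embedded
`φ : M ↪ K(X)^r` (`…FullSheafEmbedding`, stub-4) with full sheaf `M~ = 𝒪_X · φ(M)`, choose generators
`m₁ … m_N` and pv-024's presentation `q : 𝒪_X^N ↠ M~`, `𝒦 := ker q`, `F := 𝓗om(M~, 𝒦)`.
* `F` is finite locally free, affine-localizing, of affine-finite type (`…FullSheafCoh`, A1/A2);
* on a finite affine cover `𝒰`, `0 → 𝓗om(M~,𝒦) → 𝓗om(M~,𝒪^N) → 𝓔nd(M~) → 0` has Čech exactness data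
  (stub-4 A3, p508363) with connecting map `δ : Ȟ⁰(𝓔nd M~) → Ȟ¹(F)`, onto by (vii) (stub-4 A6);
* `End_T(M) → Ȟ⁰(𝒰, 𝓔nd M~)`, `u ↦ (ũ|_{U_i})_i` (`sheafHomOf`, p508318, and Mathlib's restriction
  to `⊤`) is `T`-linear (`overTop_sheafHomOf_smul`) and bijective by (ii) (`sheafHomEquiv`);
* **A5** `δ(ũ) = 0 ⟺ u ∈ P(M, M)`: exactness at `Ȟ⁰(𝓔nd M~)` (`Morphisms/CechModuleExactH0`) says
  `δ(ũ) = 0` iff `ũ` lifts to `ψ : M~ → 𝒪_X^N`; through `𝒪_X^N ≅ (T^N)~` (stub-4 `…FullSheafFree`,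
  `presentation_pi_comp_sheafHomOf`) and `Hom(M~, (T^N)~) = Hom_T(M, T^N)` ((ii) for `T^N`,
  `sheafHomEquiv`) this is `u = (Σ aₖmₖ) ∘ h` for some `h : M → T^N`, i.e. `u ∈ P(M, M)` (stub-5
  `mem_projFactoring_iff_exists_comp_eq`, p500785);
* **A7** hence `End̲_T(M) = End_T(M)/P(M,M) ≃ₗ[T] Ȟ¹(𝒰, F)` (`LinearMap.quotKerEquivOfSurjective`).

References (all via the tree; the dictionary is that of M. Artin, J.-L. Verdier, *Reflexive modules over
rational double points*, Math. Ann. 270 (1985) 79–82 [`ArtinVerdier1985`], used here only as a guide).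
-/

-- single-problem summit: the doubled namespace component `ResolutionOfSingularities` is forced
set_option linter.dupNamespace false

noncomputable section

universe u v

open CategoryTheory CategoryTheory.Limits AlgebraicGeometry TopologicalSpace Opposite
open Literature.AlgebraicGeometry.Resolution Literature.AlgebraicGeometry.Morphisms
open Literature.AlgebraicGeometry.Modules
open Literature.AlgebraicGeometry.Motives (IsFiniteLocallyFree)

namespace Summit.ResolutionOfSingularities.ResolutionOfSingularities.Theorems.NoZeno.SandwichCluster.FullSheaf

/-! ## Čech `H⁰` plumbing: global sections of `𝓗om` versus morphisms -/

section Plumbing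

variable {A : Type u} [CommRing A] {X : Scheme.{u}} (f : X ⟶ Spec (.of A)) {ι : Type v}
  (U : ι → X.Opens) (hU : ⨆ i, U i = ⊤)

/-- Naturality of `Γ(X, M) ≅ Ȟ⁰(𝒰, M)` (`cechMH0EquivSections`) in `M`. [folklore] -/
theorem cechMapH0_cechMH0EquivSections {M N : X.Modules} (φ : M ⟶ N) (s : MSections f M ⊤) :
    cechMapH0 f φ U (cechMH0EquivSections f U M hU s) =
      cechMH0EquivSections f U N hU (MSections.app f φ ⊤ s) := by
  apply Subtype.ext
  funext i
  rw [cechMapH0_coe, cechMapC0_apply]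
  change MSections.app f φ (U i) (MSections.res f M le_top s) = MSections.res f N le_top _
  rw [MSections.res_app]

/-- The global section of `𝓗om(E, N)` attached to `g ≫ q` is the image of that of `g` under
`𝓗om(E, q)`. [folklore] -/
theorem overFunctor_map_comp_eq_app {E P N : X.Modules} (g : E ⟶ P) (q : P ⟶ N) :
    ((SheafOfModules.overFunctor X.ringCatSheaf ⊤).map (g ≫ q) : MSections f (sheafHom E N) ⊤) =
      MSections.app f (sheafHomMap E q) ⊤
        ((SheafOfModules.overFunctor X.ringCatSheaf ⊤).map g : MSections f (sheafHom E P) ⊤) := by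
  rw [Functor.map_comp]
  rfl

end Plumbing

/-! ## `End_T(M) → Γ(X, 𝓔nd M~)` is `T`-linear; functoriality of `sheafHomOf` -/

section Linear

variable {X : Scheme.{u}} [IsIntegral X]
variable {T : Type u} [CommRing T] [IsDomain T] [Algebra T X.functionField] [IsFractionRing T X.functionField]
variable {V : Type u} [AddCommGroup V] [Module X.functionField V] [Module T V] [IsScalarTower T X.functionField V]
variable {V' : Type u} [AddCommGroup V'] [Module X.functionField V'] [Module T V']
  [IsScalarTower T X.functionField V']
variable {V'' : Type u} [AddCommGroup V''] [Module X.functionField V''] [Module T V'']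
  [IsScalarTower T X.functionField V'']
variable {M : Type*} [AddCommGroup M] [Module T M] {M' : Type*} [AddCommGroup M'] [Module T M']
  {M'' : Type*} [AddCommGroup M''] [Module T M'']
variable (φ : M →ₗ[T] V) (φ' : M' →ₗ[T] V') (φ'' : M'' →ₗ[T] V'')
variable (hφinj : Function.Injective φ) (hspan : Submodule.span X.functionField (Set.range φ) = ⊤)
variable (hφ'inj : Function.Injective φ') (hspan' : Submodule.span X.functionField (Set.range φ') = ⊤)


include hφinj hspan hφ'inj hspan' in
/-- **Functoriality of `sheafHomOf`**: `(v ∘ u)~ = ũ ≫ ṽ`. [this work] -/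
theorem sheafHomOf_comp (u : M →ₗ[T] M') (v : M' →ₗ[T] M'') :
    sheafHomOf (X := X) φ φ' hφinj hspan u ≫ sheafHomOf φ' φ'' hφ'inj hspan' v =
      sheafHomOf φ φ'' hφinj hspan (v ∘ₗ u) := by
  refine hom_ext_of_app_ofMem V (Set.range φ) _ _ fun U _ _ w hw => ?_
  obtain ⟨m, rfl⟩ := hw
  rw [Scheme.Modules.Hom.comp_app, CategoryTheory.comp_apply, sheafHomOf_app_ofMem,
    sheafHomOf_app_ofMem, sheafHomOf_app_ofMem]
  rfl

include hφinj hspan in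
/-- Additivity of `u ↦ ũ|_⊤ ∈ Γ(X, 𝓗om(M~, M′~))`. [folklore] -/
theorem overFunctor_map_sheafHomOf_add (π : X ⟶ Spec (.of T)) (u u' : M →ₗ[T] M') :
    ((SheafOfModules.overFunctor X.ringCatSheaf ⊤).map (sheafHomOf (X := X) φ φ' hφinj hspan (u + u')) :
        MSections π (sheafHom (generatedSheaf V (Set.range φ)) (generatedSheaf V' (Set.range φ'))) ⊤) =
      ((SheafOfModules.overFunctor X.ringCatSheaf ⊤).map (sheafHomOf φ φ' hφinj hspan u) :
        MSections π (sheafHom (generatedSheaf V (Set.range φ)) (generatedSheaf V' (Set.range φ'))) ⊤) +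
      ((SheafOfModules.overFunctor X.ringCatSheaf ⊤).map (sheafHomOf φ φ' hφinj hspan u') :
        MSections π (sheafHom (generatedSheaf V (Set.range φ)) (generatedSheaf V' (Set.range φ'))) ⊤) := by
  rw [sheafHomOf_add]
  refine hom_ext_of_appLE fun W k s => ?_
  rw [appLE_add, appLE_over_map, appLE_over_map, appLE_over_map, Scheme.Modules.Hom.add_app]
  rfl

include hφinj hspan in
/-- **`T`-linearity of `u ↦ ũ|_⊤ ∈ Γ(X, 𝓗om(M~, M′~))`** for the `T`-module structure of sections over
`Spec T` (`a • ψ = ψ ≫ (a|_⊤ · )`, `T → Γ(X, 𝒪_X)` acting on `𝓗om`; stated in the unfolded form, which is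
definitionally the scalar multiplication of `MSections π (𝓗om(M~, M′~)) ⊤`): both sides have value
`a • ũ(s)` on a section `s`, since `T` acts on `K(X)` through `Γ(W, 𝒪_X)` (`evalFn_res_algebraMapΓ`).
[this work] -/
theorem overFunctor_map_sheafHomOf_smul (π : X ⟶ Spec (.of T))
    (halg : algebraMap T X.functionField = baseToFunctionField π) (a : T) (u : M →ₗ[T] M') :
    (SheafOfModules.overFunctor X.ringCatSheaf ⊤).map (sheafHomOf (X := X) φ φ' hφinj hspan (a • u)) =
      (SheafOfModules.overFunctor X.ringCatSheaf ⊤).map (sheafHomOf φ φ' hφinj hspan u) ≫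
        overScalar _ ⊤ (algebraMap T (Sections π ⊤) a) := by
  refine hom_ext_of_appLE fun W k s => ?_
  rw [appLE_over_map, appLE_comp, appLE_overScalar, appLE_over_map]
  refine section_ext V' (Set.range φ') (funext fun y => ?_)
  rw [fn_sheafHomOf_app, fn_smul, fn_sheafHomOf_app, homLift_smul, LinearMap.smul_apply,
    Sections.algebraMap_apply]
  have hk : (X.presheaf.map (homOfLE (le_top : (⊤ : X.Opens) ≤ ⊤)).op ≫ X.presheaf.map k.op) =
      X.presheaf.map (homOfLE (le_top : W ≤ ⊤)).op := by
    rw [← Functor.map_comp]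
    rfl
  rw [← CategoryTheory.comp_apply, hk, evalFn_res_algebraMapΓ, ← halg, algebraMap_smul]

end Linear

/-! ## The assembly: `End̲_T(M) ≃ₗ[T] Ȟ¹(𝒰, 𝓗om(M~, 𝒦))` -/

section Assembly

variable {T : Type u} [CommRing T] [IsDomain T] [IsNoetherianRing T] [IsIntegrallyClosed T]
variable {X : Scheme.{u}} [IsIntegral X] [IsLocallyNoetherian X] (π : X ⟶ Spec (.of T))
variable (M : Type u) [AddCommGroup M] [Module T M] [Module.Finite T M]


/-- **G2-MAIN from the typed inputs (iv), (vii).** Let `T` be a noetherian normal domain,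
`π : X → Spec T` a resolution (`X` integral, locally noetherian), `M` a finite reflexive `T`-module.
ASSUME (iv) «every full sheaf `𝒪_X · φ(M) ⊆ K(X)^r_X` of `M` is finite locally free» (`hLF`) and
(vii) «`Ȟ¹(𝒰, (𝒪_X · φ(M))^∨) = 0` on finite affine covers» (`hdual`), both in the shape of
`SketchG2Split.lean` v2. THEN there is a finite locally free, affine-localizing, affine-finite-type
`𝒪_X`-module `F` (namely `𝓗om(M~, 𝒦)` for a presentation `0 → 𝒦 → 𝒪_X^N → M~ → 0`) with
`End̲_T(M) ≃ₗ[T] Ȟ¹(𝒰, F)` for EVERY finite affine open cover `𝒰` of `X`. [this work] -/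
theorem exists_locallyFree_stableEnd_equiv_cechMH1_of_inputs (hπ : IsResolution π)
    (hM : Module.IsReflexive T M)
    (hLF : ∀ (r : ℕ) (φ : M →+ (Fin r → X.functionField)),
      (∀ (a : T) (m : M), φ (a • m) = baseToFunctionField π a • φ m) → Function.Injective φ →
        IsFiniteLocallyFree (generatedSheaf (X := X) (Fin r → X.functionField) (Set.range φ)))
    (hdual : ∀ (r : ℕ) (φ : M →+ (Fin r → X.functionField)),
      (∀ (a : T) (m : M), φ (a • m) = baseToFunctionField π a • φ m) → Function.Injective φ →
        ∀ (ι : Type) [Finite ι] (U : ι → X.Opens), (∀ i, IsAffineOpen (U i)) → ⨆ i, U i = ⊤ →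
          Subsingleton (CechMH1 π
            (dual (generatedSheaf (X := X) (Fin r → X.functionField) (Set.range φ))) U)) :
    ∃ F : X.Modules, IsFiniteLocallyFree F ∧ IsAffineLocalizing F ∧ IsAffineFiniteType F ∧
      ∀ (ι : Type) [Finite ι] (U : ι → X.Opens), (∀ i, IsAffineOpen (U i)) → ⨆ i, U i = ⊤ →
        Nonempty (StableEnd T M ≃ₗ[T] CechMH1 π F U) := by
  -- `K(X) = Frac T` along `baseToFunctionField π`
  letI : Algebra T X.functionField := (baseToFunctionField π).toAlgebra
  haveI : IsDominant π := hπ.isBirational.isDominant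
  haveI : IsFractionRing T X.functionField :=
    isFractionRing_baseToFunctionField π hπ.isBirational.isIso_stalkMap_genericPoint
  have halg : algebraMap T X.functionField = baseToFunctionField π := rfl
  haveI : Nonempty (⊤ : X.Opens) := nonempty_top
  have hρ : ∀ a : T, X.germToFunctionField ⊤ (algebraMapΓ π a) = algebraMap T X.functionField a :=
    fun _ => rfl
  haveI := hM
  -- the embedding `φ : M ↪ K(X)^r` with `K(X)`-spanning image (stub-4), its full sheaf `M~`
  obtain ⟨r, φ, hφinj, hspan, -⟩ :=
    exists_injective_linearMap_pi_span_eq_top (T := T) X.functionField M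
  have hφ : ∀ (a : T) (m : M),
      φ.toAddMonoidHom (a • m) = baseToFunctionField π a • φ.toAddMonoidHom m := fun a m => by
    rw [LinearMap.toAddMonoidHom_coe, map_smul]
    funext j
    rw [Pi.smul_apply, Pi.smul_apply, smul_eq_mul, Algebra.smul_def]
    rfl
  have hLF' : IsFiniteLocallyFree (generatedSheaf (X := X) (Fin r → X.functionField) (Set.range φ)) :=
    hLF r φ.toAddMonoidHom hφ hφinj
  have hcoh : Coh (generatedSheaf (X := X) (Fin r → X.functionField) (Set.range φ)) :=
    coh_fullSheaf (Fin r → X.functionField) π φ.toAddMonoidHom hφ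
  have hH0 : ∀ v : Fin r → X.functionField,
      (∀ x : X, v ∈ stalkSpan (X := X) (Fin r → X.functionField) (Set.range φ) x) ↔ v ∈ Set.range φ :=
    fullSheaf_range_linear_eq_of_isScalarTower π halg hπ hM φ hφinj
  -- generators `m₁ … m_N`, the presentation `q : 𝒪_X^N ↠ M~`, `F := 𝓗om(M~, ker q)`
  obtain ⟨N, m, hm⟩ := Module.Finite.exists_fin (R := T) (M := M)
  have hqM : Function.Surjective (Fintype.linearCombination T m) :=
    (span_range_eq_top_iff_surjective_fintypeLinearCombination T m).mp hm
  haveI hq : Epi (presentation (X := X) (Fin r → X.functionField) (Set.range φ)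
      (Set.rangeFactorization φ ∘ m)) :=
    epi_presentation _ _ _ fun U hU hne => by
      haveI := hne
      exact span_range_ofMem_generators_eq_top π φ.toAddMonoidHom hφ m hm hU
  obtain ⟨hFlf, hFcoh⟩ := isFiniteLocallyFree_and_coh_sheafHom_kernel
    (presentation (X := X) (Fin r → X.functionField) (Set.range φ) (Set.rangeFactorization φ ∘ m))
    (isFiniteLocallyFree_freeMod N) hLF' (coh_freeMod N) hcoh
  refine ⟨_, hFlf, hFcoh.loc, hFcoh.ft, fun ι _ U hU hcov => ?_⟩
  -- the full sheaf `(T^N)~ ≅ 𝒪_X^N` of `ιN : T^N ↪ K(X)^N` (compatibly with `q`), and (ii) for `T^N`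
  have hC := presentation_pi_comp_sheafHomOf (X := X) φ m
  set ιN := (Algebra.linearMap T X.functionField).compLeft (Fin N) with hιN_def
  have hιN : Function.Injective ιN := compLeft_algebraMap_injective T _ N
  have hspanN := span_range_compLeft_algebraMap T X.functionField N
  have hH0N : ∀ v : Fin N → X.functionField,
      (∀ x : X, v ∈ stalkSpan (X := X) (Fin N → X.functionField)
        (Set.range ιN) x) ↔
        v ∈ Set.range ιN :=
    fullSheaf_range_linear_eq_of_isScalarTower π halg hπ inferInstance _ hιN
  haveI := isIso_presentation_pi π halg N
  set pT := presentation (X := X) (Fin N → X.functionField)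
    (Set.range ιN)
    (Set.rangeFactorization ιN ∘
      fun i => Pi.single i 1) with hpT
  set q := presentation (X := X) (Fin r → X.functionField) (Set.range φ) (Set.rangeFactorization φ ∘ m)
    with hq_def
  -- Čech exactness data of `0 → 𝓗om(M~,𝒦) → 𝓗om(M~,𝒪^N) → 𝓔nd(M~) → 0` (stub-4 A3); `δ` onto (A6)
  have hdata := cechExactData_sheafHom_presentation (Fin r → X.functionField) (Set.range φ) π U
    (Set.rangeFactorization φ ∘ m) hLF' hU
  have hδ : Function.Surjective hdata.cechDelta :=
    cechDelta_surjective_sheafHom_presentation _ _ π U _ hdata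
      (hdual r φ.toAddMonoidHom hφ hφinj ι U hU hcov)
  -- `cT : End_T(M) → Γ(X, 𝓔nd M~)`, `u ↦ ũ|_⊤`, `T`-linear and bijective ((ii), `sheafHomEquiv`)
  let cT : Module.End T M →ₗ[T]
      MSections π (sheafHom (generatedSheaf (X := X) (Fin r → X.functionField) (Set.range φ))
        (generatedSheaf (X := X) (Fin r → X.functionField) (Set.range φ))) ⊤ :=
    { toFun := fun u =>
        (SheafOfModules.overFunctor X.ringCatSheaf ⊤).map (sheafHomOf φ φ hφinj hspan u)
      map_add' := fun u u' => overFunctor_map_sheafHomOf_add φ φ hφinj hspan π u u'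
      map_smul' := fun a u => overFunctor_map_sheafHomOf_smul φ φ hφinj hspan π halg a u }
  have hcT : Function.Bijective cT :=
    overFunctor_top_map_bijective.comp
      (sheafHomEquiv φ φ hφinj hspan hφinj (algebraMapΓ π) hρ hH0).bijective
  -- `L := δ ∘ (Γ ≅ Ȟ⁰) ∘ cT : End_T(M) → Ȟ¹(𝒰, F)`, onto
  let L : Module.End T M →ₗ[T] CechMH1 π (sheafHom (generatedSheaf (X := X) (Fin r → X.functionField)
      (Set.range φ)) (kernel (presentation (X := X) (Fin r → X.functionField) (Set.range φ)
        (Set.rangeFactorization φ ∘ m)))) U :=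
    hdata.cechDelta ∘ₗ (cechMH0EquivSections π U _ hcov).toLinearMap ∘ₗ cT
  have hL : Function.Surjective L :=
    hδ.comp ((cechMH0EquivSections π U _ hcov).surjective.comp hcT.2)
  -- A5: `ker L = P(M, M)`
  have hker : LinearMap.ker L = projFactoring T M M := by
    ext u
    rw [LinearMap.mem_ker, mem_projFactoring_iff_exists_comp_eq _ hqM]
    constructor
    · intro hu
      -- exactness at `Ȟ⁰(𝓔nd M~)`: `ũ|_⊤` lifts to a global section `ψt` of `𝓗om(M~, 𝒪_X^N)`
      obtain ⟨b, hb⟩ := hdata.exists_cechMapH0_eq_of_cechDelta_eq_zero _ hu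
      have hψ : MSections.app π (sheafHomMap _ q) ⊤ ((cechMH0EquivSections π U _ hcov).symm b) = cT u := by
        apply (cechMH0EquivSections π U _ hcov).injective
        rw [← cechMapH0_cechMH0EquivSections, LinearEquiv.apply_symm_apply, hb]
        rfl
      -- hence `ψ' ≫ q = ũ` for the morphism `ψ' : M~ ⟶ 𝒪_X^N` it defines
      have hψ' : homOfTop ((cechMH0EquivSections π U _ hcov).symm b) ≫ q =
          sheafHomOf φ φ hφinj hspan u := by
        have h1 := congrArg homOfTop hψ
        rw [MSections.app_apply, sheafHomMap_app_apply, homOfTop_comp, homOfTop_overFunctor_map] at h1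
        exact h1.trans (homOfTop_overFunctor_map _)
      -- through `𝒪_X^N ≅ (T^N)~`, `ψ'` is `h̃` for some `h : M → T^N`, and `u = (Σ aₖ mₖ) ∘ h`
      refine ⟨homOfSheafHom φ ιN hιN (algebraMapΓ π) hρ hH0N
        (homOfTop ((cechMH0EquivSections π U _ hcov).symm b) ≫ pT), ?_⟩
      apply (sheafHomEquiv φ φ hφinj hspan hφinj (algebraMapΓ π) hρ hH0).injective
      change sheafHomOf φ φ hφinj hspan u = sheafHomOf φ φ hφinj hspan _
      rw [← sheafHomOf_comp φ ιN φ hφinj hspan hιN hspanN, sheafHomOf_homOfSheafHom, Category.assoc,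
        hC, hψ']
    · rintro ⟨h, rfl⟩
      -- `ũ = h̃ ≫ (Σ aₖ mₖ)~ = (h̃ ≫ ((T^N)~ ≅ 𝒪_X^N)) ≫ q`, so `ũ|_⊤` comes from `Ȟ⁰(𝓗om(M~, 𝒪^N))`
      let ψ'' : generatedSheaf (X := X) (Fin r → X.functionField) (Set.range φ) ⟶ freeMod X N :=
        sheafHomOf φ ιN hφinj hspan h ≫ inv pT
      have hfac : sheafHomOf φ φ hφinj hspan (Fintype.linearCombination T m ∘ₗ h) = ψ'' ≫ q := by
        rw [← sheafHomOf_comp φ ιN φ hφinj hspan hιN hspanN, ← hC]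
        simp only [ψ'', Category.assoc, IsIso.inv_hom_id_assoc]
        rfl
      have hmap : (SheafOfModules.overFunctor X.ringCatSheaf ⊤).map
          (sheafHomOf φ φ hφinj hspan (Fintype.linearCombination T m ∘ₗ h)) =
          (SheafOfModules.overFunctor X.ringCatSheaf ⊤).map ψ'' ≫
            (SheafOfModules.overFunctor X.ringCatSheaf ⊤).map q := by
        rw [hfac]
        exact Functor.map_comp _ _ _
      have key := cechMapH0_cechMH0EquivSections π U hcov
        (sheafHomMap (generatedSheaf (X := X) (Fin r → X.functionField) (Set.range φ)) q)
        ((SheafOfModules.overFunctor X.ringCatSheaf ⊤).map ψ'')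
      rw [MSections.app_apply, sheafHomMap_app_apply] at key
      have final : hdata.cechDelta (cechMH0EquivSections π U _ hcov
          ((SheafOfModules.overFunctor X.ringCatSheaf ⊤).map ψ'' ≫
            (SheafOfModules.overFunctor X.ringCatSheaf ⊤).map q)) = 0 := by
        rw [← key]
        exact hdata.cechDelta_cechMapH0 _
      exact (congrArg (fun z => hdata.cechDelta (cechMH0EquivSections π U _ hcov z)) hmap).trans final
  -- A7: `End̲_T(M) = End_T(M) ⧸ P(M, M) ≃ₗ[T] Ȟ¹(𝒰, F)`
  exact ⟨(Submodule.quotEquivOfEq _ _ hker.symm).trans (LinearMap.quotKerEquivOfSurjective L hL)⟩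

end Assembly

end Summit.ResolutionOfSingularities.ResolutionOfSingularities.Theorems.NoZeno.SandwichCluster.FullSheaf

end
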